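import Mathlib
import HarnessLib

/-!
# Imbrie (2016), Assumption LLA(ν, C) ("limited level attraction") — TYPED STATEMENT ONLY

CITATION HEADER (lean-in-tree rule 2026-08-18). J. Z. Imbrie, *On many-body localization for quantum spin chains*,
J. Stat. Phys. **163** (2016) 998–1048, doi 10.1007/s10955-016-1508-x, arXiv:1403.7837 [ImbrieJSP2016]; companion letter
*Diagonalization and many-body localization for a disordered quantum spin chain*, Phys. Rev. Lett. **117** (2016) 027201,
arXiv:1605.03003 [ImbriePRL2016]. WHAT IS REPRODUCED: the model (1.1) with + boundary conditions, the admissibility of the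
coupling laws (p. 1000), and the unproved hypothesis eq. (1.3) = eq. (5.2) "Assumption LLA(ν,C)" together with the two forms
actually consumed by Theorem 1.1 (uniformity in γ ∈ (0, γ₀]; the weaker A2(ν, ε₀) of Ch. 5, eq. (5.1)). STATUS: LLA is a
HYPOTHESIS of [ImbrieJSP2016] Thm 1.1, stated by its author as unproved; it is under adjudication by the audit cell `pub-imbrie`
(packet `papers/_external/mbl-lla/`: neither proved nor refuted there; proved only at γ = 0, for δ ≥ 2γn, and for fixed n).
NOTHING in this file asserts LLA; it is a `def … : Prop` to be taken as an explicit hypothesis `(h : LLA L γ ν C)`.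

Model (1.1) on the box Λ = [-K, K'] ∩ ℤ, |Λ| = n, with + boundary conditions (S^z_i = 1 for i ∉ Λ):
  H = ∑_{i∈Λ} h_i S^z_i + ∑_{i∈Λ} γ Γ_i S^x_i + ∑_{i=-K-1}^{K'} J_i S^z_i S^z_{i+1}.
Randomness: h_i, Γ_i, J_i independent, |·| ≤ 1, densities ≤ ρ₀ (p. 1000; Ch. 4 p. 1019: continuous, supported on [-1,1]).

LLA(ν,C):  P( min_{α≠β} |E_α − E_β| < δ ) ≤ δ^ν C^n   for all δ > 0 and all n   (E_α = the 2^n eigenvalues of H_Λ).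

Design choices (the cell's reading, labelled "derived here" in its REFEREE.md R2): the minimum runs over distinct INDICES
with multiplicity (`SmallGap`), i.e. an exact degeneracy is a gap 0; the law of a box is the product of its own site/bond laws
(`Laws.boxMeasure`), so LLA quantifies over every position `a` and every length `n`. Sites of the box are re-indexed 0,…,n−1;
bonds are indexed b = 0,…,n (bond b couples site b−1 to site b; sites −1 and n carry S^z = +1).
Staged from the cell package `run/shared/lean/pub/pub-imbrie/lean/ImbrieLLA/` (namespace there `ImbrieLLA`; identical
declarations).
-/


noncomputable section
open _root_.MeasureTheory

namespace Literature.MathematicalPhysics.QuantumLattice.Imbrie2016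

/-- spin configurations of an n-site box: the tensor-product basis of (ℂ²)^{⊗n}, here over ℝ
(H is a real symmetric matrix). [cite: ImbrieJSP2016, §1 eq. (1.1)] -/
abbrev Cfg (n : ℕ) := Fin n → Bool

/-- S^z eigenvalue of site `k ∈ ℤ` in configuration σ, with the + boundary condition outside the box. [cite: ImbrieJSP2016, §1 eq. (1.1)] -/
def szZ {n : ℕ} (σ : Cfg n) (k : ℤ) : ℝ :=
  if h : 0 ≤ k ∧ k < n then (if σ ⟨k.toNat, by omega⟩ then 1 else -1) else 1

/-- the random couplings of an n-site box: fields h, transverse-field factors Γ, bonds J. [cite: ImbrieJSP2016, §1 eq. (1.1)] -/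
structure Params (n : ℕ) where
  h : Fin n → ℝ
  Γ : Fin n → ℝ
  J : Fin (n + 1) → ℝ

/-- diagonal part: ∑ h_i S^z_i + ∑_b J_b S^z_{b-1} S^z_b  (eq. (1.1) without the S^x term). [cite: ImbrieJSP2016, §1 eq. (1.1)] -/
def diagEnergy {n : ℕ} (p : Params n) (σ : Cfg n) : ℝ :=
  (∑ i : Fin n, p.h i * szZ σ i) + ∑ b : Fin (n + 1), p.J b * szZ σ ((b : ℤ) - 1) * szZ σ b

/-- σ and τ differ exactly at site i (a single spin flip). [cite: ImbrieJSP2016, §1 eq. (1.1)] -/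
def FlipAt {n : ℕ} (σ τ : Cfg n) (i : Fin n) : Prop := σ i ≠ τ i ∧ ∀ j, j ≠ i → σ j = τ j

/-- `FlipAt` is decidable (finite check). [cite: ImbrieJSP2016, §1 eq. (1.1)] -/
instance {n : ℕ} (σ τ : Cfg n) (i : Fin n) : Decidable (FlipAt σ τ i) := by
  unfold FlipAt; infer_instance

/-- off-diagonal part: γ Γ_i between configurations differing by one flip at i (S^x_i). [cite: ImbrieJSP2016, §1 eq. (1.1)] -/
def offDiag {n : ℕ} (γ : ℝ) (p : Params n) (σ τ : Cfg n) : ℝ :=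
  ∑ i : Fin n, if FlipAt σ τ i then γ * p.Γ i else 0

/-- the Hamiltonian (1.1) of the n-site box with + boundary conditions, as a real matrix. [cite: ImbrieJSP2016, §1 eq. (1.1)] -/
def H {n : ℕ} (γ : ℝ) (p : Params n) : Matrix (Cfg n) (Cfg n) ℝ :=
  Matrix.diagonal (diagEnergy p) + Matrix.of (offDiag γ p)

/-- `FlipAt` is symmetric. [cite: ImbrieJSP2016, §1 eq. (1.1)] -/
lemma flipAt_comm {n : ℕ} (σ τ : Cfg n) (i : Fin n) : FlipAt σ τ i ↔ FlipAt τ σ i := by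
  unfold FlipAt
  constructor <;> rintro ⟨h1, h2⟩ <;> exact ⟨Ne.symm h1, fun j hj => (h2 j hj).symm⟩

/-- the S^x part is a symmetric matrix. [cite: ImbrieJSP2016, §1 eq. (1.1)] -/
lemma offDiag_comm {n : ℕ} (γ : ℝ) (p : Params n) (σ τ : Cfg n) :
    offDiag γ p σ τ = offDiag γ p τ σ := by
  unfold offDiag
  refine Finset.sum_congr rfl fun i _ => ?_
  simp only [flipAt_comm σ τ i]

/-- H of (1.1) is a real symmetric (Hermitian) matrix. [cite: ImbrieJSP2016, §1 eq. (1.1)] -/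
theorem H_isHermitian {n : ℕ} (γ : ℝ) (p : Params n) : (H γ p).IsHermitian := by
  unfold H
  refine Matrix.IsHermitian.add (Matrix.isHermitian_diagonal _) ?_
  ext σ τ
  simp [Matrix.conjTranspose_apply, offDiag_comm γ p σ τ]

/-- the 2^n eigenvalues of H (with multiplicity), indexed by configurations via Mathlib's spectral theorem. [cite: ImbrieJSP2016, §1 eq. (1.1)] -/
def eigs {n : ℕ} (γ : ℝ) (p : Params n) : Cfg n → ℝ := (H_isHermitian γ p).eigenvalues

/-- the event {min_{α≠β} |E_α − E_β| < δ}: two distinct indices (multiplicity counted) at distance < δ. [cite: ImbrieJSP2016, §1 eq. (1.1)] -/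
def SmallGap {n : ℕ} (γ : ℝ) (δ : ℝ) (p : Params n) : Prop :=
  ∃ α β : Cfg n, α ≠ β ∧ |eigs γ p α - eigs γ p β| < δ

/-- an admissible single-variable law: a probability measure on ℝ carried by [-1,1] with density ≤ ρ₀
(Imbrie p. 1000: "bounded by 1, with probability densities bounded by a fixed constant ρ₀"). [cite: ImbrieJSP2016, p. 1000] -/
def Admissible (ρ₀ : ℝ) (μ : Measure ℝ) : Prop :=
  IsProbabilityMeasure μ ∧ μ ≤ (ENNReal.ofReal ρ₀) • volume.restrict (Set.Icc (-1 : ℝ) 1)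

/-- site-indexed laws of h_i, Γ_i, J_i (i ∈ ℤ); the box [a, a+n−1] uses the laws of its own sites and bonds. [cite: ImbrieJSP2016, §1 eq. (1.1)] -/
structure Laws where
  μh : ℤ → Measure ℝ
  μΓ : ℤ → Measure ℝ
  μJ : ℤ → Measure ℝ

/-- all site/bond laws admissible with the same density bound ρ₀. [cite: ImbrieJSP2016, p. 1000] -/
def Laws.Admissible (L : Laws) (ρ₀ : ℝ) : Prop :=
  ∀ i, Imbrie2016.Admissible ρ₀ (L.μh i) ∧ Imbrie2016.Admissible ρ₀ (L.μΓ i) ∧ Imbrie2016.Admissible ρ₀ (L.μJ i)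

/-- the parameter space of a box is identified with (Fin n → ℝ) × (Fin n → ℝ) × (Fin (n+1) → ℝ). [cite: ImbrieJSP2016, §1 eq. (1.1)] -/
def Params.ofTriple {n : ℕ} (t : (Fin n → ℝ) × (Fin n → ℝ) × (Fin (n + 1) → ℝ)) : Params n :=
  ⟨t.1, t.2.1, t.2.2⟩

/-- the product law of the couplings of the box [a, a+n−1]; bond b ∈ {0,…,n} is J_{a+b-1}. [cite: ImbrieJSP2016, §1 eq. (1.1)] -/
def Laws.boxMeasure (L : Laws) (a : ℤ) (n : ℕ) :
    Measure ((Fin n → ℝ) × (Fin n → ℝ) × (Fin (n + 1) → ℝ)) :=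
  (Measure.pi fun i : Fin n => L.μh (a + i)).prod
    ((Measure.pi fun i : Fin n => L.μΓ (a + i)).prod (Measure.pi fun b : Fin (n + 1) => L.μJ (a + b - 1)))

/-- **Assumption LLA(ν, C)** (Imbrie 2016, eq. (1.3)/(5.2)) for the law family `L` at coupling `γ`:
for every box [a, a+n−1] (every n ≥ 1, every position a) and every δ > 0,
P( ∃ α ≠ β, |E_α − E_β| < δ ) ≤ δ^ν C^n. UNPROVED hypothesis of Thm 1.1; never asserted here. [cite: ImbrieJSP2016, eq. (1.3)] -/
def LLA (L : Laws) (γ ν C : ℝ) : Prop :=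
  ∀ (a : ℤ) (n : ℕ), 0 < n → ∀ δ : ℝ, 0 < δ →
    L.boxMeasure a n {t | SmallGap γ δ (Params.ofTriple t)} ≤ ENNReal.ofReal (δ ^ ν * C ^ n)

/-- what Theorem 1.1 actually consumes (p. 1001 + Thm 5.1 / Cor 5.2): ν, C FIXED FIRST, then γ small —
so the assumption must hold with ν, C uniform over an interval (0, γ₀] of couplings. [cite: ImbrieJSP2016, Thm 1.1 and Cor 5.2] -/
def LLA_uniformInSmallCoupling (L : Laws) (ν C : ℝ) : Prop :=
  ∃ γ₀ > 0, ∀ γ, 0 < γ → γ ≤ γ₀ → LLA L γ ν C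

/-- the weaker form A2(ν, ε₀) of Ch. 5 (eq. (5.1)): only δ = ε̃^n is needed, for all ε̃ ≤ ε₀ and all n. [cite: ImbrieJSP2016, eq. (5.1)] -/
def A2 (L : Laws) (γ ν ε₀ : ℝ) : Prop :=
  ∀ (a : ℤ) (n : ℕ), 0 < n → ∀ ε' : ℝ, 0 < ε' → ε' ≤ ε₀ →
    L.boxMeasure a n {t | SmallGap γ (ε' ^ n) (Params.ofTriple t)} ≤ ENNReal.ofReal (ε' ^ (ν * n))

end Literature.MathematicalPhysics.QuantumLattice.Imbrie2016
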